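import Summits.QuantumFields.YangMills.Theorems.IR.TelescopedCodingCompose

/-!
# S₂∕C3 (1/4): exact `t`-fold nesting of `blockField` on odd tori

Landing file 1/4 of the S₂∕C3 development of line `smallfield-polymer-coder` (crux `BalabanLadder.IR`, stmt-QuantumFields-19354;
ideator ym-ir-idea-4 g4, 2026-08-28): the floored iteration of conditional coders `IterateCondCoders` with level-independent
constants (S₂) and the guarded one-step conditional composition over a general divisor `M' ∣ M` (C3, `1 ≤ M`), both PROVED
(`iterateCondCoders_holds`, `composeCond_pos`, file 4).  VERBATIM from `Cruxes/IR/Lines/smallfield_polymer_coder.lean` rev 6 §2b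
(namespace kept: `Summit.QuantumFields.YangMills.Cruxes.IR.SmallFieldPolymerCoder`).  Pure measure theory ∕ arithmetic over the
tree's `Theorems/IR/TelescopedCoding*` API; sorry-free.  HONESTY: plumbing only — nothing here bears on the Yang–Mills mass gap (Clay),
a lattice gap or `BalabanLadder.IR`; R4 of the ladder closes only the conditional finite-𝕋⁴ rung `BalabanLadder.UV`.

Landed for item `stmt-QuantumFields-19354` (`--supports … --as helper`) by the LEAD prover ab-p1 (director-ym №14 (3) landing lane; ideator's OFFER
2026-08-28T05:58:49Z); authored by ideator ym-ir-idea-4 g4, split of the sorry-free workfile `Cruxes/IR/Lines/smallfield_polymer_coder_S2.lean` rev 2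
(94b95b4dc241) per `Cruxes/IR/Lines/smallfield_polymer_coder_S2_LANDING.md` v2 (four files `SmallFieldCoderS2{Nesting,LawStep,Locality,Iterate}`).
-/

set_option autoImplicit false

noncomputable section

open MeasureTheory
open Literature.MathematicalPhysics.QuantumFieldTheory Literature.MathematicalPhysics.QuantumLattice
open Summit.QuantumFields.YangMills.Cruxes.IR.TelescopedCoding

namespace Summit.QuantumFields.YangMills.Cruxes.IR.SmallFieldPolymerCoder

/-! ## §S2.1 Block bases, natural links, exact `t`-fold nesting of `blockField` (`nestMul`, `blockField_mul`) -/

section Nesting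

variable {G : Type}

/-- Base point (natural coordinates `M ⌊x_l / M⌋`) of the `M`-block containing the site of `q`. -/
def blockBase (M N : ℕ) (q : Edge 4 N) : Fin 4 → ℕ := fun l => M * ((q.1 l).val / M)

/-- The torus link at natural coordinates `c`, direction `i`. -/
def natLink (N : ℕ) (c : Fin 4 → ℕ) (i : Fin 4) : Edge 4 N := (fun l => ((c l : ℕ) : ZMod N), i)

/-- The direction component of `natLink N c i` is `i`. -/
theorem natLink_snd (N : ℕ) (c : Fin 4 → ℕ) (i : Fin 4) : (natLink N c i).2 = i := rfl

/-- The coordinates of `natLink N c i` are the given naturals `c l` (when `c l < N`). -/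
theorem natLink_val {N : ℕ} [NeZero N] {c : Fin 4 → ℕ} (hc : ∀ l, c l < N) (i l : Fin 4) :
    ((natLink N c i).1 l).val = c l := by
  simp only [natLink, ZMod.val_natCast, Nat.mod_eq_of_lt (hc l)]

/-- `blockField M N U q` as the ordered product of the link variables along the block line from `blockBase`. -/
theorem blockField_eq_prod [Group G] (M N : ℕ) (U : GaugeConfig 4 N G) (q : Edge 4 N) :
    blockField M N U q = (((List.range M).filter fun j => blockBase M N q q.2 + j < N).map fun j =>
      U (torusEdge N ((fun l => ((blockBase M N q l : ℕ) : ℤ)) + Pi.single q.2 (j : ℤ), q.2))).prod := rfl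

/-- `blockField` in normal form: a product over a list of NATURAL offsets (the definition's list carries a coercion
through the `List` monad). -/
theorem blockField_apply' [Group G] (M N : ℕ) (U : GaugeConfig 4 N G) (q : Edge 4 N) :
    blockField M N U q = (((List.range M).filter fun j => blockBase M N q q.2 + j < N).map fun j : ℕ =>
      U (torusEdge N ((fun l => ((blockBase M N q l : ℕ) : ℤ)) + Pi.single q.2 ((j : ℕ) : ℤ), q.2))).prod := by
  rw [blockField_eq_prod]
  simp only [bind_pure_comp, List.map_eq_map, List.map_map]
  rfl

/-- The block base of a link sitting at an `M`-corner with in-range coordinates is that corner. -/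
theorem blockBase_natLink {M N : ℕ} [NeZero N] {c : Fin 4 → ℕ} (hc : ∀ l, c l < N) (hdiv : ∀ l, M ∣ c l)
    (i : Fin 4) : blockBase M N (natLink N c i) = c := by
  funext l
  simp only [blockBase, natLink_val hc, Nat.mul_div_cancel' (hdiv l)]

/-- `blockBase M N q l < N`. -/
theorem blockBase_lt {M N : ℕ} [NeZero N] (q : Edge 4 N) (l : Fin 4) : blockBase M N q l < N :=
  lt_of_le_of_lt (Nat.mul_div_le _ _) (ZMod.val_lt _)

/-- `M ∣ blockBase M N q l` (the block base sits on the `M`-lattice). -/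
theorem dvd_blockBase (M N : ℕ) (q : Edge 4 N) (l : Fin 4) : M ∣ blockBase M N q l := ⟨_, rfl⟩

/-- `blockField 1` is the identity. -/
theorem blockField_one [Group G] {N : ℕ} [NeZero N] (U : GaugeConfig 4 N G) : blockField 1 N U = U := by
  funext q
  rw [blockField_apply']
  have hb : ∀ l, blockBase 1 N q l = (q.1 l).val := fun l => by simp [blockBase]
  have hfilt : ((List.range 1).filter fun j => blockBase 1 N q q.2 + j < N) = [(0 : ℕ)] := by
    rw [List.range_one, List.filter_singleton]
    have : decide (blockBase 1 N q q.2 + 0 < N) = true := by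
      rw [decide_eq_true_eq, hb, add_zero]; exact ZMod.val_lt _
    rw [this]; rfl
  rw [hfilt]
  simp only [List.map_cons, List.map_nil, List.prod_cons, List.prod_nil, mul_one]
  congr 1
  refine Prod.ext ?_ rfl
  funext l
  simp only [torusEdge, Literature.Probability.LatticeModels.Torus.proj, hb, Nat.cast_zero, Pi.single_zero,
    add_zero, Int.cast_natCast, ZMod.natCast_zmod_val]

/-- **General nesting map**: the `tM`-block field as a function of the `M`-block field `W` — the product of the `M`-block values at
the `t` consecutive `M`-corners of the `tM`-block line, dropping those that start outside the fundamental domain. -/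
def nestMul [Group G] (t M N : ℕ) (W : GaugeConfig 4 N G) : GaugeConfig 4 N G := fun q =>
  (((List.range t).filter fun m => blockBase (t * M) N q q.2 + m * M < N).map fun m : ℕ =>
      W (natLink N (blockBase (t * M) N q + Pi.single q.2 (m * M)) q.2)).prod

/-- `nestMul t M N` is measurable (finite products in a measurable group). -/
theorem measurable_nestMul [Group G] [MeasurableSpace G] [MeasurableMul₂ G] (t M N : ℕ) :
    Measurable (nestMul (G := G) t M N) := by
  refine measurable_pi_lambda _ fun q => ?_
  have h : (fun W : GaugeConfig 4 N G => nestMul t M N W q) = fun W =>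
      ((((List.range t).filter fun m => blockBase (t * M) N q q.2 + m * M < N).map
        fun (m : ℕ) (W : GaugeConfig 4 N G) => W (natLink N (blockBase (t * M) N q + Pi.single q.2 (m * M)) q.2)).map
        fun f => f W).prod := by
    funext W; simp only [nestMul, List.map_map]; rfl
  rw [h]
  refine List.measurable_fun_prod _ fun f hf => ?_
  obtain ⟨m, -, rfl⟩ := List.mem_map.1 hf
  exact measurable_pi_apply _

/-- One straight line of `t·M` links from an `M`-corner `c` in direction `i` (truncated at the domain edge) is the product of
the `t` consecutive `M`-block values along it. -/
theorem blockLine_aux [Group G] {M N : ℕ} [NeZero N] (U : GaugeConfig 4 N G) (c : Fin 4 → ℕ)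
    (hcN : ∀ l, c l < N) (hcM : ∀ l, M ∣ c l) (i : Fin 4) (t : ℕ) :
    (((List.range (t * M)).filter fun j => c i + j < N).map fun j : ℕ =>
        U (torusEdge N ((fun l => ((c l : ℕ) : ℤ)) + Pi.single i ((j : ℕ) : ℤ), i))).prod =
    (((List.range t).filter fun m => c i + m * M < N).map fun m : ℕ =>
        blockField M N U (natLink N (c + Pi.single i (m * M)) i)).prod := by
  set f : ℕ → G := fun j => U (torusEdge N ((fun l => ((c l : ℕ) : ℤ)) + Pi.single i ((j : ℕ) : ℤ), i)) with hf
  induction t with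
  | zero => simp
  | succ t ih =>
    have hr : List.range ((t + 1) * M) = List.range (t * M) ++ (List.range M).map (fun j => t * M + j) := by
      rw [Nat.succ_mul, List.range_add]
    rw [hr, List.filter_append, List.map_append, List.prod_append, ih, List.range_succ, List.filter_append,
      List.map_append, List.prod_append]
    congr 1
    set c' : Fin 4 → ℕ := c + Pi.single i (t * M) with hc'
    rw [List.filter_map, List.map_map, List.filter_singleton]
    by_cases hlt : c i + t * M < N
    · rw [decide_eq_true hlt]
      simp only [cond_true, List.map_cons, List.map_nil, List.prod_cons, List.prod_nil, mul_one]
      rw [blockField_apply', natLink_snd]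
      have hc'N : ∀ l, c' l < N := by
        intro l
        by_cases hl : l = i
        · rw [hl]; simpa [hc'] using hlt
        · simp only [hc', Pi.add_apply, Pi.single_eq_of_ne hl, add_zero]; exact hcN l
      have hc'M : ∀ l, M ∣ c' l := by
        intro l
        by_cases hl : l = i
        · rw [hl]; simpa [hc'] using (hcM i).add (Dvd.intro_left t rfl)
        · simp only [hc', Pi.add_apply, Pi.single_eq_of_ne hl, add_zero]; exact hcM l
      rw [blockBase_natLink hc'N hc'M]
      have hpred : ((fun j => decide (c i + j < N)) ∘ fun j => t * M + j) = fun j => decide (c' i + j < N) := by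
        funext j; simp only [Function.comp, hc', Pi.add_apply, Pi.single_eq_same, add_assoc]
      have hsum : (f ∘ fun j => t * M + j) = fun j : ℕ =>
          U (torusEdge N ((fun l => ((c' l : ℕ) : ℤ)) + Pi.single i (j : ℤ), i)) := by
        funext j
        simp only [Function.comp, hf]
        congr 2
        refine Prod.ext ?_ rfl
        funext l
        by_cases hl : l = i
        · rw [hl]; simp only [hc', Pi.add_apply, Pi.single_eq_same]; push_cast; ring
        · simp only [hc', Pi.add_apply, Pi.single_eq_of_ne hl, add_zero]
      rw [hpred, hsum]
    · have hd : decide (c i + t * M < N) = false := decide_eq_false hlt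
      rw [hd]
      simp only [cond_false, List.map_nil, List.prod_nil]
      have hnil : ((List.range M).filter ((fun j => decide (c i + j < N)) ∘ fun j => t * M + j)) = [] := by
        rw [List.filter_eq_nil_iff]
        intro j _
        simp only [Function.comp, decide_eq_true_eq, not_lt]
        omega
      rw [hnil, List.map_nil, List.prod_nil]

/-- **`blockField` nests exactly under any integer coarsening of the block side** (odd or even torus, any `M > 0`, any `t`). -/
theorem blockField_mul [Group G] {t M N : ℕ} [NeZero N] (_hM : 0 < M) (U : GaugeConfig 4 N G) :
    blockField (t * M) N U = nestMul t M N (blockField M N U) := by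
  funext q
  simp only [nestMul]
  rw [blockField_apply' (t * M)]
  exact blockLine_aux U (blockBase (t * M) N q) (fun l => blockBase_lt q l)
    (fun l => (Dvd.intro_left t rfl : M ∣ t * M).trans (dvd_blockBase (t * M) N q l)) q.2 t

end Nesting

end Summit.QuantumFields.YangMills.Cruxes.IR.SmallFieldPolymerCoder

end
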